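import Mathlib
import HarnessLib
import Literature.MathematicalPhysics.QuantumLattice.GrassmannDefectSplit
import Summits.HubbardSuperconductivity.HubbardSuperconductivity.Theorems.KLProgrammeKLRegimeTwoVolumeLipGluedWt
import Summits.HubbardSuperconductivity.HubbardSuperconductivity.Theorems.KLProgrammeKLRegimeTwoVolumeSubstitutionGluingDeepPin

/-!
# Route `KLProgramme` — crux K3 ENGINE (stmt-HubbardSuperconductivity-20437), stub (e) proof-input «(e)-D-ROWS», F-D4c (generic): THE TRANSFER DOOR AT THE
# CANONICAL BLOCK STRUCTURE `klBlockEquiv` / `klBlockEmb` / `klGlue`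
# (seat hubbard-kl-k3c4-p1 g23; `--supports` 20437; DROWS-SCOPE-g23 §9.2/§9.4 F-D4c, F-D6)

k3c5-p2's deep-pin transfer door `…TwoVolumeSubstitutionGluingDeepPin.sum_norm_kernel_map_sub_glue_map_le_of_defect` is stated for an abstract block structure
`e : Γ′ ≃ ι × Γ` with block embeddings `Fe`.  The (D) rows use it at the CANONICAL block structure of the two-volume tower (`…TwoVolumeTowerSpineDefs.klBlockEquiv`,
`…TwoVolumeLipTowerDefs.klBlockEmb / klGlue`, `…TwoVolumeLipGluedWt.klResLabel`) twice — for the source term of a block (transfer `klLipTransfer`) and for the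
remeasurement of the difference tower at a finer family (transfer = re-sectorisation matrix).  This file packages that instantiation once:

* `klGlue_transfer_le` — for ANY pair of transfer matrices `T′` (fine), `T` (coarse) related by the periodisation `Σ_{res Y″ = Y} T′ X′ Y″ = T (res X′) Y`, any
  `W′`, `W`: the door's bound for `map (toLin′ T′) W′ − klGlue (map (toLin′ T) W)` at an output pin, with `hFe` discharged (`klBlockEmb_apply`) and the glue by `rfl`.

A composition of landed theorems; rows / profiles are hypotheses; nothing asserts the (D) rows, stub (e), VL, K3 or superconductivity.
References: BGM 2006 (2.77)–(2.90), §3 [cite: BenfattoGiulianiMastropietro2006]; Salmhofer 1998 §4.1.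
-/

namespace Summit.HubbardSuperconductivity.HubbardSuperconductivity.Theorems.TwoVolumeLip

set_option linter.dupNamespace false -- summit = problem name (single-conjunct summit), D-0017

open Finset Literature.MathematicalPhysics.QuantumLattice GrassmannAlgebra
open Summit.HubbardSuperconductivity.HubbardSuperconductivity.Theorems.TwoVolumeSource
open Summit.HubbardSuperconductivity.HubbardSuperconductivity.Theorems.TwoVolumeDefect

noncomputable section

variable {L b M : ℕ} [NeZero L] [NeZero (b * L)]

/-- **The transfer door at the canonical block structure.**  For transfer matrices `T′` (fine, `Γ_{N₂}(bL) × Γ_{N₁}(bL)`) and `T` (coarse) related by the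
PERIODISATION `Σ_{res Y″ = Y} T′ X′ Y″ = T (res X′) Y` (`klResLabel`), any fine element `W′` and coarse element `W`, at an output pin `w′` (leg `p`):
`Σ_{X′ p = w′} ‖kernel (map (toLin′ T′) W′ − klGlue (map (toLin′ T) W)) X′‖ ≤ aⁿ(aE + τ·ND) + (2aⁿτN + n·aⁿ(5τN + 2a·N_far))` — k3c5-p2's
`…TwoVolumeSubstitutionGluingDeepPin.sum_norm_kernel_map_sub_glue_map_le_of_defect` with `e₁, e₂ := klBlockEquiv`, `Fe₁, Fe₂ := klBlockEmb` (`klBlockEmb_apply`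
discharges `hFe`), the glue `klGlue` recognised by `rfl`.  Named: column / window / pin rows `a` and far tails `τ` of `T′` w.r.t. zone predicates `Z`, `Near`,
`Far` (coarse input labels) and `NearF` (fine input labels); the profiles `N`, `N_far` of `W`; the defect profiles `E` (on `NearF` pins), `ND` of `W′ − klGlue W`.
Used twice by the (D) rows: with `T′, T := klLipTransfer (bL), klLipTransfer L` (the source term of a block, `…LipSourceTransfer.lipSourceTransfer_le`) and with the
re-sectorisation (jump) matrices (the remeasurement of the difference tower, F-D6). -/
theorem klGlue_transfer_le {N₁ N₂ : ℕ} (T' : Matrix (SpaceTimeIdx (b * L) M × SectorLeg N₂) (SpaceTimeIdx (b * L) M × SectorLeg N₁) ℂ)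
    (T : Matrix (SpaceTimeIdx L M × SectorLeg N₂) (SpaceTimeIdx L M × SectorLeg N₁) ℂ)
    (hP : ∀ (X' : SpaceTimeIdx (b * L) M × SectorLeg N₂) (Y : SpaceTimeIdx L M × SectorLeg N₁),
      ∑ Y'' ∈ univ.filter (fun Y'' : SpaceTimeIdx (b * L) M × SectorLeg N₁ => klResLabel L b M N₁ Y'' = Y), T' X' Y'' = T (klResLabel L b M N₂ X') Y)
    (W' : GrassmannAlgebra ℂ (SpaceTimeIdx (b * L) M × SectorLeg N₁)) (W : GrassmannAlgebra ℂ (SpaceTimeIdx L M × SectorLeg N₁))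
    {n : ℕ} (p : Fin (n + 1)) (w' : SpaceTimeIdx (b * L) M × SectorLeg N₂)
    (Z Near : SpaceTimeIdx L M × SectorLeg N₁ → Prop) [DecidablePred Z] [DecidablePred Near]
    (Far : SpaceTimeIdx L M × SectorLeg N₁ → SpaceTimeIdx L M × SectorLeg N₁ → Prop)
    [DecidableRel Far] (hZ : ∀ y y', Near y → Z y' → Far y y')
    (NearF : SpaceTimeIdx (b * L) M × SectorLeg N₁ → Prop) [DecidablePred NearF]
    {a τ N Nfar E ND : ℝ} (ha : 0 ≤ a) (hτ0 : 0 ≤ τ) (hN0 : 0 ≤ N) (hNfar0 : 0 ≤ Nfar) (hE0 : 0 ≤ E) (hND0 : 0 ≤ ND)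
    (hcol : ∀ y', ∑ x, ‖T' x y'‖ ≤ a)
    (hwin : ∀ (B' : Fin 2 → Fin b) (y : SpaceTimeIdx L M × SectorLeg N₁),
      ∑ B : Fin 2 → Fin b, ∑ x ∈ univ.filter (fun x : SpaceTimeIdx (b * L) M × SectorLeg N₂ =>
          (klBlockEquiv L b M N₂ x).1 = B'),
        ‖T' x ((klBlockEquiv L b M N₁).symm (B, y))‖ ≤ a)
    (hρ : ∑ y, ‖T' w'
        ((klBlockEquiv L b M N₁).symm ((klBlockEquiv L b M N₂ w').1, y))‖ ≤ a)
    (hrowF : ∑ y' ∈ univ.filter (fun y' : SpaceTimeIdx (b * L) M × SectorLeg N₁ => NearF y'),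
      ‖T' w' y'‖ ≤ a)
    (hτF : ∑ y' ∈ univ.filter (fun y' : SpaceTimeIdx (b * L) M × SectorLeg N₁ => ¬ NearF y'),
      ‖T' w' y'‖ ≤ τ)
    (hτ₁ : ∀ y, ¬ Z y → ∑ x ∈ univ.filter (fun x : SpaceTimeIdx (b * L) M × SectorLeg N₂ =>
        (klBlockEquiv L b M N₂ x).1 ≠ (klBlockEquiv L b M N₂ w').1),
      ‖T' x
        ((klBlockEquiv L b M N₁).symm ((klBlockEquiv L b M N₂ w').1, y))‖ ≤ τ)
    (hτ₂ : ∑ B ∈ univ.erase (klBlockEquiv L b M N₂ w').1, ∑ y,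
      ‖T' w' ((klBlockEquiv L b M N₁).symm (B, y))‖ ≤ τ)
    (hτ₃ : ∑ y ∈ univ.filter (fun y : SpaceTimeIdx L M × SectorLeg N₁ => ¬ Near y),
      ‖T' w'
        ((klBlockEquiv L b M N₁).symm ((klBlockEquiv L b M N₂ w').1, y))‖ ≤ τ)
    (hτ₄ : ∀ y, ¬ Z y → ∑ B ∈ univ.erase (klBlockEquiv L b M N₂ w').1,
      ∑ x ∈ univ.filter (fun x : SpaceTimeIdx (b * L) M × SectorLeg N₂ =>
          (klBlockEquiv L b M N₂ x).1 = (klBlockEquiv L b M N₂ w').1),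
        ‖T' x ((klBlockEquiv L b M N₁).symm (B, y))‖ ≤ τ)
    (hN : ∀ y, ∑ Y ∈ univ.filter (fun Y : Fin (n + 1) → SpaceTimeIdx L M × SectorLeg N₁ => Y p = y),
      ‖kernel ℂ W (n + 1) Y‖ ≤ N)
    (hNfar : ∀ y (i : Fin (n + 1)),
      ∑ Y ∈ univ.filter (fun Y : Fin (n + 1) → SpaceTimeIdx L M × SectorLeg N₁ => Y p = y ∧ Far (Y p) (Y i)),
        ‖kernel ℂ W (n + 1) Y‖ ≤ Nfar)
    (hE : ∀ y', NearF y' →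
      ∑ Y' ∈ univ.filter (fun Y' : Fin (n + 1) → SpaceTimeIdx (b * L) M × SectorLeg N₁ => Y' p = y'),
        ‖kernel ℂ (W' - klGlue L b M N₁ W) (n + 1) Y'‖ ≤ E)
    (hND : ∀ y',
      ∑ Y' ∈ univ.filter (fun Y' : Fin (n + 1) → SpaceTimeIdx (b * L) M × SectorLeg N₁ => Y' p = y'),
        ‖kernel ℂ (W' - klGlue L b M N₁ W) (n + 1) Y'‖ ≤ ND) :
    ∑ X' ∈ univ.filter (fun X' : Fin (n + 1) → SpaceTimeIdx (b * L) M × SectorLeg N₂ => X' p = w'),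
        ‖kernel ℂ (ExteriorAlgebra.map (Matrix.toLin' T') W' - klGlue L b M N₂ (ExteriorAlgebra.map (Matrix.toLin' T) W)) (n + 1) X'‖ ≤
      a ^ n * (a * E + τ * ND) + (2 * a ^ n * τ * N + n * a ^ n * (5 * τ * N + 2 * a * Nfar)) := by
  have hmain := sum_norm_kernel_map_sub_glue_map_le_of_defect (𝕜 := ℂ) (klBlockEquiv L b M N₁) (klBlockEquiv L b M N₂) T T' hP
    (klBlockEmb L b M N₁) (fun B v X' => klBlockEmb_apply B v X') (klBlockEmb L b M N₂) (fun B v X' => klBlockEmb_apply B v X')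
    W' W p w' Z Near Far hZ NearF ha hτ0 hN0 hNfar0 hE0 hND0 hcol hwin hρ hrowF hτF hτ₁ hτ₂ hτ₃ hτ₄ hN hNfar hE hND
  refine Eq.trans_le (Finset.sum_congr rfl fun X' _ => ?_) hmain
  rw [kernel_sub']
  rfl

end

end Summit.HubbardSuperconductivity.HubbardSuperconductivity.Theorems.TwoVolumeLip
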